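import Summits.ValiantsHypothesis.ValiantsHypothesis.Theorems.TwoProducts.RankThreeAffineWronskianFewnomial
import Summits.ValiantsHypothesis.ValiantsHypothesis.Theorems.TwoProducts.RankThreeAffineOLMColumns

/-!
# Rank three AFFINE, OLM COLUMNS by the WRONSKIAN LADDER (COL′): `nv (Σ_{i<K} X^{e_i}·ψ_i(u)) ≤ (t+2)^(8·K² + 6)` — exponent QUADRATIC in the number of columns

The K-direction of the OLM residue of record (crit-8 g5 #91: «every ladder in the tree pays `t^{O(5^K)}` (columns)») re-run through the WRONSKIAN LADDER
✓ `card_Eset_unitSumW_le` (`…RankThreeAffineWronskianLadder`; closed form `flagBound_le` and base arithmetic from `…RankThreeAffineWronskianFewnomial`; val-port-1 g5): the monomials `X^{e_i}` are UNITS for `D = J(·,u)` (`M = 1`,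
`J(X^e, u) = X^e·(e₀·θ₁u − e₁·θ₀u)`, ✓ `theta_monomial`; numerator `≤ 2t` terms, NO edge slopes), and the univariate columns `ψ_i(u)` are `D`-CONSTANTS
(✓ `jac_aeval_self`) — so the flag Wronskians are built from the monomials only and the bound is UNIFORM in the `ψ_i` (column heights free), as in
✓ `olmColumns_nv_le` (`…RankThreeAffineOLMColumns`, val-port-4 g5), but with exponent `O(K²)` instead of `O(5^K)`.
RESULTS: `one_mul_jac_monomial`, `card_support_colNumerator_le`, `two_mul_le_flagBound`, `def colBoundW K t := 2·flagBound t (wEB t 1 (2t) 1) 0 K + 4`,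
★★ `columnSumW_nv_le : nv (Σ_{i∈I} X^{e_i}·ψ_i(u)) ≤ colBoundW K t` (`|I| ≤ K`, `|supp u| ≤ t`, nothing else), `olmColumnsW_nv_le` (`Fin K` form),
★ `olmW_nv_le_of_columns` (OLM-explicit: u-free projections of `supp P` in `≤ K` columns, via ✓ `aeval_olm_eq_columnSum`),
★ `colBoundW_le_pow : colBoundW K t ≤ (t+2)^(6·K·K + 2·K + 6)`, ★★ `olmColumnsLawQuad : ∃ c₀ c₁ ∀ K t u I e ψ, nv ≤ (t+2)^(c₀·K·K + c₁)` (`(8, 6)`) —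
versus ✓ `olmColumnsLaw` (`∀ K ∃ c`, `c = 2·colExp K + 3`, `colExp K ≍ 5^K`).
HONEST LABEL: located class on an OPEN rung; `K`-UNIFORMITY is NOT claimed (exponent `≍ K²`, and `K ≤ (m+1)(m+2)/2` grows with the degree `m`, so this is
`t^{O(m⁴)}`, not the `poly(m,t)` that `OLMLaw` wants); the residue of record (TW-count / merged resonances, crit-8 #91) is UNMOVED; nothing here closes 5906 /
`RankThreeAffineLaw` / `OLMLaw` / `PlanarCellBound` / `ResidualLawV25`; `TwoProducts` OPEN; VP ≠ VNP is NOT proved here or anywhere in this tree.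
`--supports stmt-ValiantsHypothesis-5906 --as helper`.  No instances, no notation, no named facts. [folklore]
-/

noncomputable section
set_option linter.dupNamespace false

namespace Summit.ValiantsHypothesis.ValiantsHypothesis.Theorems.TwoProducts.RankTwoJacobian

open scoped BigOperators Pointwise Classical
open MvPolynomial

/-! ### §1 Monomials are units for `D = J(·,u)`; their numerators -/

/-- **Monomials are units:** `1·J(X^e, u) = X^e · (e₀·θ₁u − e₁·θ₀u)` (✓ `theta_monomial`). [folklore] -/
theorem one_mul_jac_monomial (e : Expo) (u : Poly2) :
    (1 : Poly2) * jac (monomial e 1) u = monomial e 1 * (C ((e 0 : ℕ) : ℂ) * theta 1 u - C ((e 1 : ℕ) : ℂ) * theta 0 u) := by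
  have h : ∀ c : ℂ, (monomial e 1 : Poly2) * C c = monomial e c := fun c => by rw [mul_comm, C_mul_monomial, mul_one]
  rw [one_mul, jac, theta_monomial, theta_monomial, one_mul, one_mul, mul_sub, ← mul_assoc, ← mul_assoc, h, h]

/-- Size of the numerator: `|supp (e₀·θ₁u − e₁·θ₀u)| ≤ 2t`. [folklore] -/
theorem card_support_colNumerator_le (e : Expo) {u : Poly2} {t : ℕ} (hu : u.support.card ≤ t) :
    (C ((e 0 : ℕ) : ℂ) * theta 1 u - C ((e 1 : ℕ) : ℂ) * theta 0 u).support.card ≤ 2 * t := by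
  have h1 := (card_supp_C_mul_le ((e 0 : ℕ) : ℂ) (theta 1 u)).trans ((Finset.card_le_card (support_theta_subset 1 u)).trans hu)
  have h0 := (card_supp_C_mul_le ((e 1 : ℕ) : ℂ) (theta 0 u)).trans ((Finset.card_le_card (support_theta_subset 0 u)).trans hu)
  have hs := card_supp_sub_le (C ((e 0 : ℕ) : ℂ) * theta 1 u) (C ((e 1 : ℕ) : ℂ) * theta 0 u)
  omega

/-- A monomial has `≤ 1` edge slope (it has `≤ 1` term). [folklore] -/
theorem card_Eset_monomial_le (σ : ℝ) (e : Expo) : (Eset σ (monomial e (1 : ℂ) : Poly2)).card ≤ 1 := by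
  have h1 : ((monomial e (1 : ℂ) : Poly2)).support.card ≤ 1 := (Finset.card_le_card support_monomial_subset).trans (by simp)
  exact (card_Eset_le_sq σ _ h1).trans (by norm_num)

/-- `2n ≤ flagBound t B i n` (every step costs at least `2`). [folklore] -/
theorem two_mul_le_flagBound (t : ℕ) (B : ℕ → ℕ) : ∀ n i : ℕ, 2 * n ≤ flagBound t B i n
  | 0, i => by simp [flagBound]
  | n + 1, i => by
    show 2 * (n + 1) ≤ 3 * (t * t + t) + 3 * B (i + 1) + B i + 2 + flagBound t B (i + 1) n
    have ih := two_mul_le_flagBound t B n (i + 1)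
    omega

/-! ### §2 The column bound -/

/-- THE WRONSKIAN COLUMN BOUND `colBoundW K t = 2·flagBound t (wEB t 1 (2t) 1) 0 K + 4` (`M = 1`, numerators `≤ 2t` terms, `≤ 1` edge slope per monomial). -/
def colBoundW (K t : ℕ) : ℕ := 2 * flagBound t (wEB t 1 (2 * t) 1) 0 K + 4

/-- ★★ **MONOMIAL COLUMNS, quadratic exponent:** for `u` with `≤ t` monomials, ANY index set `|I| ≤ K`, ANY exponents `e_i` (repeated or resonant allowed)
and ANY univariate columns `ψ_i`:  `nv (Σ_{i∈I} X^{e_i}·ψ_i(u)) ≤ colBoundW K t`. -/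
theorem columnSumW_nv_le {ι : Type*} (K t : ℕ) (u : Poly2) (hu : u.support.card ≤ t) (I : Finset ι) (hI : I.card ≤ K)
    (e : ι → Expo) (ψ : ι → Polynomial ℂ) :
    nv (∑ i ∈ I, monomial (e i) (1 : ℂ) * Polynomial.aeval u (ψ i)) ≤ colBoundW K t := by
  unfold colBoundW
  by_cases hS : (S1 u).Nonempty
  · have hM : (1 : Poly2) ≠ 0 := one_ne_zero
    have hμ : (1 : Poly2).support.card ≤ 1 := by rw [MvPolynomial.support_one, Finset.card_singleton]
    have hb : ∀ σ : ℝ, σ = 1 ∨ σ = -1 →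
        (Eset σ (∑ i ∈ I, monomial (e i) (1 : ℂ) * Polynomial.aeval u (ψ i))).card ≤ flagBound t (wEB t 1 (2 * t) 1) 0 K := fun σ hσ =>
      card_Eset_unitSumW_le hσ hS hu hM hμ (fun i => (monomial (e i) (1 : ℂ) : Poly2))
        (fun i => C ((e i 0 : ℕ) : ℂ) * theta 1 u - C ((e i 1 : ℕ) : ℂ) * theta 0 u)
        (fun i => one_mul_jac_monomial (e i) u) (fun i => card_support_colNumerator_le (e i) hu)
        (fun i => card_Eset_monomial_le σ (e i)) I (fun i => Polynomial.aeval u (ψ i)) (fun i _ => jac_aeval_self u (ψ i)) hI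
    have h1 := hb 1 (Or.inl rfl)
    have h2 := hb (-1) (Or.inr rfl)
    have hn := nv_le (∑ i ∈ I, monomial (e i) (1 : ℂ) * Polynomial.aeval u (ψ i))
    omega
  · -- constant carrier: the sum is `Σ_i ψ_i(c)·X^{e_i}`, at most `|I| ≤ K` monomials
    have huC : u = C (coeff 0 u) := eq_C_of_S1_empty hS
    have hval : ∀ i, Polynomial.aeval u (ψ i) = C ((ψ i).eval (coeff 0 u)) := fun i => by
      rw [show Polynomial.aeval u (ψ i) = Polynomial.aeval (C (coeff 0 u) : Poly2) (ψ i) by rw [← huC]]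
      exact aeval_C_eq _ _
    have hsum : ∑ i ∈ I, monomial (e i) (1 : ℂ) * Polynomial.aeval u (ψ i) =
        ∑ i ∈ I, (monomial (e i) ((ψ i).eval (coeff 0 u)) : Poly2) := by
      refine Finset.sum_congr rfl fun i _ => ?_
      rw [hval i, mul_comm, C_mul_monomial, mul_one]
    rw [hsum]
    have hK := (nv_le_card_support _).trans
      ((card_support_sum_monomial_le I e (fun i => (ψ i).eval (coeff 0 u))).trans hI)
    have := two_mul_le_flagBound t (wEB t 1 (2 * t) 1) K 0
    omega

/-- ★★ **`K` u-FREE COLUMNS, k-UNIFORM, quadratic exponent** (`Fin K` form of `columnSumW_nv_le`). -/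
theorem olmColumnsW_nv_le (K t : ℕ) (u : Poly2) (hu : u.support.card ≤ t) (e : Fin K → Expo) (ψ : Fin K → Polynomial ℂ) :
    nv (∑ i, monomial (e i) 1 * Polynomial.aeval u (ψ i)) ≤ colBoundW K t :=
  columnSumW_nv_le K t u hu Finset.univ (by simp) e ψ

/-- ★ **OLM-explicit:** if the u-free projections of `supp P` lie in a set of `≤ K` columns, then `nv (P(x,y,u)) ≤ colBoundW K t` for every `u` with
`≤ t` monomials — uniformly in the u-degree of `P` (✓ `aeval_olm_eq_columnSum`). -/
theorem olmW_nv_le_of_columns (K t : ℕ) (u : Poly2) (hu : u.support.card ≤ t) (P : Poly3) (cols : Finset Expo) (hK : cols.card ≤ K)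
    (hP : ∀ s ∈ P.support, Finsupp.single 0 (s 0) + Finsupp.single 1 (s 1) ∈ cols) :
    nv (MvPolynomial.aeval ![(X 0 : Poly2), X 1, u] P) ≤ colBoundW K t := by
  rw [aeval_olm_eq_columnSum u P cols hP]
  exact columnSumW_nv_le K t u hu cols hK (fun c => c) (colPoly P)

/-! ### §3 The law: exponent quadratic in `K` -/

/-- ★ **Power form:** `colBoundW K t ≤ (t+2)^(6·K·K + 2·K + 6)`. [folklore] -/
theorem colBoundW_le_pow (K t : ℕ) : colBoundW K t ≤ (t + 2) ^ (6 * K * K + 2 * K + 6) := by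
  have hX1 : 0 < t + 2 := by omega
  have hX : 1 < t + 2 := by omega
  -- `wEB t 1 (2t) 1 K = K + (K!·(3t+1)^{K·K})² ≤ X^(6KK+K+1)`
  have hθ : 2 * t + 1 * t + 1 ≤ (t + 2) ^ 2 := by nlinarith
  have hK : K ≤ (t + 2) ^ K := (Nat.lt_pow_self hX).le
  have hfact : K.factorial ≤ (t + 2) ^ (K * K) := by
    rw [pow_mul]
    exact (Nat.factorial_le_pow K).trans (Nat.pow_le_pow_left hK K)
  have hpow : (2 * t + 1 * t + 1) ^ (K * K) ≤ (t + 2) ^ (2 * (K * K)) :=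
    (Nat.pow_le_pow_left hθ (K * K)).trans (pow_mul (t + 2) 2 (K * K)).symm.le
  have hprod : K.factorial * (2 * t + 1 * t + 1) ^ (K * K) ≤ (t + 2) ^ (3 * (K * K)) := by
    have := Nat.mul_le_mul hfact hpow
    rw [← pow_add] at this
    have e : K * K + 2 * (K * K) = 3 * (K * K) := by ring
    rwa [e] at this
  have hsq : (K.factorial * (2 * t + 1 * t + 1) ^ (K * K)) ^ 2 ≤ (t + 2) ^ (6 * K * K) := by
    have := Nat.pow_le_pow_left hprod 2
    rw [← pow_mul] at this
    have e : 3 * (K * K) * 2 = 6 * K * K := by ring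
    rwa [e] at this
  have hW : wEB t 1 (2 * t) 1 K ≤ (t + 2) ^ (6 * K * K + K + 1) := by
    unfold wEB
    rw [Nat.mul_one]
    have hA : (t + 2) ^ K ≤ (t + 2) ^ (6 * K * K + K) := Nat.pow_le_pow_right hX1 (by omega)
    have hB : (t + 2) ^ (6 * K * K) ≤ (t + 2) ^ (6 * K * K + K) := Nat.pow_le_pow_right hX1 (by omega)
    have h2 := two_mul_pow_le t (show 6 * K * K + K < 6 * K * K + K + 1 by omega)
    omega
  have hF := flagBound_le t (B := wEB t 1 (2 * t) 1) (fun i j h => wEB_mono t 1 (2 * t) 1 h) K 0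
  rw [Nat.zero_add] at hF
  -- step cost `S ≤ X^3 + 4·X^(6KK+K+1) ≤ X^(6KK+K+4)`
  have hS1 : 3 * (t * t + t) + 2 ≤ (t + 2) ^ 3 := by
    have h3 : (t + 2) ^ 3 = t ^ 3 + 6 * (t * t) + 12 * t + 8 := by ring
    rw [h3]; omega
  have hS2 : 4 * wEB t 1 (2 * t) 1 K ≤ (t + 2) ^ (6 * K * K + K + 3) := by
    have h22 : 4 ≤ (t + 2) ^ 2 := by nlinarith
    calc 4 * wEB t 1 (2 * t) 1 K ≤ (t + 2) ^ 2 * (t + 2) ^ (6 * K * K + K + 1) := Nat.mul_le_mul h22 hW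
      _ = (t + 2) ^ (6 * K * K + K + 3) := by rw [← pow_add]; ring_nf
  have hS : 3 * (t * t + t) + 4 * wEB t 1 (2 * t) 1 K + 2 ≤ (t + 2) ^ (6 * K * K + K + 4) := by
    have hA : (t + 2) ^ 3 ≤ (t + 2) ^ (6 * K * K + K + 3) := Nat.pow_le_pow_right hX1 (by omega)
    have h2 := two_mul_pow_le t (show 6 * K * K + K + 3 < 6 * K * K + K + 4 by omega)
    omega
  have hRS : K * (3 * (t * t + t) + 4 * wEB t 1 (2 * t) 1 K + 2) ≤ (t + 2) ^ (6 * K * K + 2 * K + 4) := by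
    calc _ ≤ (t + 2) ^ K * (t + 2) ^ (6 * K * K + K + 4) := Nat.mul_le_mul hK hS
      _ = (t + 2) ^ (6 * K * K + 2 * K + 4) := by rw [← pow_add]; ring_nf
  unfold colBoundW
  have hE := hF.trans hRS
  have h2a := two_mul_pow_le t (show 6 * K * K + 2 * K + 4 < 6 * K * K + 2 * K + 5 by omega)
  have h4le : 4 ≤ (t + 2) ^ (6 * K * K + 2 * K + 5) :=
    le_trans (by nlinarith : 4 ≤ (t + 2) ^ 2) (Nat.pow_le_pow_right hX1 (by omega))
  have h2b := two_mul_pow_le t (show 6 * K * K + 2 * K + 5 < 6 * K * K + 2 * K + 6 by omega)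
  omega

/-- ★★ **The monomial-column law with exponent QUADRATIC in `K`:** absolute `c₀, c₁` (`= 8, 6`) with `nv (Σ_{i∈I} X^{e_i}·ψ_i(u)) ≤ (t+2)^(c₀·K·K + c₁)` for all
`t`-sparse `u`, all index sets `|I| ≤ K`, all exponents and all univariate columns — versus ✓ `olmColumnsLaw` (`∀ K ∃ c`, `c = 2·colExp K + 3 ≍ 5^K`).
`OLMLaw` wants the exponent independent of `K ~ m²`; NOT claimed. -/
theorem olmColumnsLawQuad : ∃ c₀ c₁ : ℕ, ∀ (K t : ℕ) (u : Poly2), u.support.card ≤ t →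
    ∀ {ι : Type} (I : Finset ι), I.card ≤ K → ∀ (e : ι → Expo) (ψ : ι → Polynomial ℂ),
      nv (∑ i ∈ I, monomial (e i) (1 : ℂ) * Polynomial.aeval u (ψ i)) ≤ (t + 2) ^ (c₀ * K * K + c₁) := by
  refine ⟨8, 6, fun K t u hu _ I hI e ψ => (columnSumW_nv_le K t u hu I hI e ψ).trans ((colBoundW_le_pow K t).trans ?_)⟩
  have hK : K ≤ K * K := Nat.le_mul_self K
  exact Nat.pow_le_pow_right (by omega) (by nlinarith)

end Summit.ValiantsHypothesis.ValiantsHypothesis.Theorems.TwoProducts.RankTwoJacobian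

end
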